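import Literature.ModelTheory.PseudofiniteFields.DefinableSetsFiniteFieldsTransferProofs
import HarnessLib

/-!
# Definable sets over finite fields (Chatzidakis–van den Dries–Macintyre 1992): decomposition into Prop. (3.3) and Prop. (2.7)

Topic `Literature/ModelTheory/PseudofiniteFields`.  The named fact
`Literature.ModelTheory.PseudofiniteFields.ChatzidakisVanDenDriesMacintyre1992_mainTheorem`
(`DefinableSetsFiniteFields.lean`; Z. Chatzidakis, L. van den Dries, A. Macintyre, *Definable
sets over finite fields*, J. reine angew. Math. 427 (1992) 107–135, Main Theorem = Thm. (3.7):
`| |φ(K^m; ā)| − μ·q^d | ≤ C·q^{d−1/2}` with finitely many `(d, μ)`) is proved in the tree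
(`mainTheorem_of_prop33_of_prop27psf`, `DefinableSetsFiniteFieldsTransferProofs.lean`, on top of
the formalisation of all of §3 in `DefinableSetsFiniteFieldsProofs.lean`) from exactly the two
printed inputs of §3 that are results of their own:

1. `ChatzidakisVanDenDriesMacintyre1992_prop33` — **Prop. (3.3)**: Lang–Weil for arbitrary affine
   algebraic sets `V(f_1, …, f_r) ⊆ 𝔸ⁿ`, `deg f_i ≤ e`, over finite fields, uniformly in
   `(e, n, r)` (from Lang–Weil 1954, Thm. 1 in all dimensions and the decomposition bounds (1.7);
   the tree's proved hypersurface case is `CafureMatera2006_thm52_holds`);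
2. `ChatzidakisVanDenDriesMacintyre1992_prop27` — **Prop. (2.7), principal (pseudo-finite)
   clause**: each formula is equivalent, uniformly over all enriched pseudo-finite fields, to a
   conjunction of formulas `∃T g(c, X, T) = 0` (van den Dries' normal form (2.4) for perfect PAC
   fields, the coding (2.2), Ax 1968).

Both are stated verbatim as the hypotheses `h33`, `h27` of the landed theorem (rendering
conventions in the section `PrintedInputs` of `DefinableSetsFiniteFieldsProofs.lean`).  Assembly:
`ChatzidakisVanDenDriesMacintyre1992_mainTheorem_holds_of`.  Neither child restates the parent:
(1) concerns zero sets of polynomial systems with an INTEGER leading coefficient `μ ≤ M(e, n, r)`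
(the number of top-dimensional components), not definable sets; (2) is a quantifier-simplification
statement about infinite fields with no counting in it.

## References

* Z. Chatzidakis, L. van den Dries, A. Macintyre, *Definable sets over finite fields*, J. reine
  angew. Math. 427 (1992) 107–135: (1.7), (2.2)–(2.7) (pp. 110–118), Prop. (3.3), Lemma (3.5),
  Thm. (3.7) (pp. 121–125). [ChatzidakisVanDenDriesMacintyre1992]
* S. Lang, A. Weil, *Number of points of varieties in finite fields*, Amer. J. Math. 76 (1954),
  Thm. 1. [LangWeil1954]
* J. Ax, *The elementary theory of finite fields*, Ann. of Math. 88 (1968) 239–271. [Ax1968]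
-/

namespace Literature.ModelTheory.PseudofiniteFields

open FirstOrder FirstOrder.Language FirstOrder.Ring
open scoped Polynomial

/-- **Chatzidakis–van den Dries–Macintyre 1992, Proposition (3.3)** (p. 121: "For each triple
`(e, n, r)` of positive integers there are a positive constant `C = C(e, n, r)` and a positive
integer `M = M(e, n, r)` such that for every finite field `k = 𝔽_q` and all
`f_1, …, f_r ∈ k[X_1, …, X_n]` of degree `≤ e`, the algebraic set `V = V(f_1, …, f_r)` satisfies
`V(k) = ∅` or `| |V(k)| − μ q^d | ≤ C q^{d − 1/2}` for some `d ≤ dim V` and some integer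
`1 ≤ μ ≤ M`" — `μ` being the number of absolutely irreducible components of `V` of top dimension
defined over `k`; from Lang–Weil [10], Thm. 1, in all dimensions together with the bounds (1.7)
on the decomposition–intersection procedure of §1).  Rendering (that of the hypothesis `h33` of
`mainTheorem_of_prop33_of_prop27psf`, verbatim): `V(k)` is the subtype of common zeros in `kⁿ`,
`q = Fintype.card k`, real powers, and `d ≤ n` in place of `d ≤ dim V` (weaker, all that §3
uses).  The tree proves the hypersurface case of the underlying Lang–Weil estimate
(`Literature.NumberTheory.DiophantineGeometry.CafureMatera2006_thm52_holds`).
[cite: ChatzidakisVanDenDriesMacintyre1992, Prop. (3.3)] [cite: LangWeil1954, Thm. 1] -/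
def ChatzidakisVanDenDriesMacintyre1992_prop33 : Prop :=
  ∀ (e n r : ℕ), ∃ (C : ℝ) (M : ℕ), 0 < C ∧
    ∀ (K : Type) [Field K] [Fintype K] (f : Fin r → MvPolynomial (Fin n) K),
      (∀ i, (f i).totalDegree ≤ e) →
        Nat.card {y : Fin n → K // ∀ i, MvPolynomial.eval y (f i) = 0} = 0 ∨
          ∃ d μ : ℕ, (d ≤ n ∧ 1 ≤ μ ∧ μ ≤ M) ∧
            |(Nat.card {y : Fin n → K // ∀ i, MvPolynomial.eval y (f i) = 0} : ℝ)
                - μ * (Fintype.card K : ℝ) ^ d|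
              ≤ C * (Fintype.card K : ℝ) ^ ((d : ℝ) - 1 / 2)

/-- **Chatzidakis–van den Dries–Macintyre 1992, Proposition (2.7), principal clause** (p. 117:
"Each `L(c)`-formula `φ(X)` is equivalent, uniformly for all enriched pseudo-finite fields, to a
conjunction of formulas `∃T (g(c, X, T) = 0)`, with `g(C, X, T) ∈ ℤ[C, X, T]`"; pseudo-finite
fields = the infinite models of the theory of finite fields (p. 110, (2.3), (2.5); Ax 1968),
enrichments `c` as in (2.6): for each `n = k + 2 ≤ B + 1` the constants `c_{n,i}` are the
coefficients of an irreducible monic polynomial of degree `n`).  Rendering (that of the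
hypothesis `h27` of `mainTheorem_of_prop33_of_prop27psf`, verbatim): for every ring formula `φ`
in `X = (X_1, …, X_m)` there are a depth `B`, a number `L` and ring terms `g_1, …, g_L` in the
variables `(C, X, T)` such that in every infinite field `K ⊨ finiteFieldTheory` (with Mathlib's
compatible ring structure `CompatibleRing K`), for every enrichment `c` of depth `B` and every
`x ∈ K^m`, `φ(x) ↔ ⋀_l ∃ t, g_l(c, x, t) = 0`.  The finite-field clause of (2.7) follows "by pure
logic" and is the tree's `prop27_finite_of_psf`.  Printed proof: van den Dries' positive
existential normal form (2.4) for perfect PAC fields with procyclic Galois group and the coding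
(2.2). [cite: ChatzidakisVanDenDriesMacintyre1992, Prop. (2.7) and (2.2)–(2.6)] [cite: Ax1968, §§7–8 (pseudo-finite fields)] -/
def ChatzidakisVanDenDriesMacintyre1992_prop27 : Prop :=
  ∀ (m : ℕ) (φ : Language.ring.Formula (Fin m)),
    ∃ (B L : ℕ)
      (g : Fin L → Language.ring.Term (((Σ k : Fin B, Fin (k.1 + 2)) ⊕ Fin m) ⊕ Fin 1)),
      ∀ (K : Type) [Field K] [CompatibleRing K] [Infinite K], K ⊨ finiteFieldTheory →
        ∀ c : (Σ k : Fin B, Fin (k.1 + 2)) → K,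
          (∀ k : Fin B, Irreducible (Polynomial.X ^ (k.1 + 2) +
            ∑ i : Fin (k.1 + 2), Polynomial.C (c ⟨k, i⟩) * Polynomial.X ^ (i : ℕ))) →
          ∀ x : Fin m → K,
            (φ.Realize x ↔
              ∀ l, ∃ t : K, (g l).realize (Sum.elim (Sum.elim c x) fun _ => t) = 0)

/-- **Assembly: the CDM Main Theorem from Prop. (3.3) and the pseudo-finite clause of
Prop. (2.7)**, by `mainTheorem_of_prop33_of_prop27psf` (all of §3 — Lemma (3.5), the normal form
(3)–(4), the counting (5)–(9) of pp. 123–125, the absorption of small fields — and the passage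
from the pseudo-finite to the finite-field clause of (2.7) being theorems of the tree).
[cite: ChatzidakisVanDenDriesMacintyre1992, Thm. (3.7) and its proof (pp. 123–125)] -/
theorem ChatzidakisVanDenDriesMacintyre1992_mainTheorem_holds_of :
    ChatzidakisVanDenDriesMacintyre1992_prop33 → ChatzidakisVanDenDriesMacintyre1992_prop27 →
      ChatzidakisVanDenDriesMacintyre1992_mainTheorem :=
  fun h33 h27 => mainTheorem_of_prop33_of_prop27psf h33 h27

end Literature.ModelTheory.PseudofiniteFields
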